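import Summits.ResolutionOfSingularities.ResolutionOfSingularities.Theorems.FrobeniusLadderFInjectiveMacaulayficationF108ConsumableHolds
import Summits.ResolutionOfSingularities.ResolutionOfSingularities.Theorems.FrobeniusLadderFInjectiveMacaulayficationFHalfRowOfWeaklyNondegenerateAnyField
import HarnessLib

/-!
# GAP-2 «k ≠ k̄»: ★★★ THE H_F CLASS LEVEL OVER EVERY FIELD OF CHARACTERISTIC `p` — the four class theorems of ✓ `…F108ClassRowUnconditional` with `[IsAlgClosed k]` REMOVED
# (crux `FInjectiveMacaulayfication` stmt-ResolutionOfSingularities-15315, chain w45a; seat res-L1-w45a-stub-2 g12; res-L1-w45a-plan-1 GO 2026-08-29T02:44:48Z «OBJECT CONFIRMED — the H_F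
# class level over EVERY field of characteristic p»; any-field twins of ✓ p680734 `…F108ClassRow` §2–§5 / ✓ p688090 `…F108ClassRowUnconditional` over this seat's
# `FHalfRowAnyField.*` (✓ `…FHalfRowOfWeaklyNondegenerateAnyField`) and res-L1-toric-fan's ✓ p687854 `F108ClassRow.F108Consumable_holds` (already field-general))

[OURS · L1 W4.5a] Support file (`--supports stmt-ResolutionOfSingularities-15315 --as helper`); def-free; UNCONDITIONAL; no named fact, no sorry, no new definition; NOT a statement of
any manuscript; replaces the role of NO printed item. Nothing of the crux is proved; no census row of a specific bed is asserted here. AI-written (AI review weaker than expert review).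

THE POINT. The registered F-half stub `LocalFullificationFibreAdmGe4Split.LocalFInjectivizationFibreAdmGe4` quantifies `∀ (k : Type) [Field k] [CharP k p]`; the class theorems of record
(`F108ClassRow.pointFloorRow_of_convenient` ✓ p688090 and every census `…RowClass/…RowUncond`) carry `[IsAlgClosed k]` — the GAP-2 member «k ≠ k̄» of CHAIN v34.8. The closure was
used at ONE callee (`NewtonChartLemma.hon_of_weaklyNondegenerate`); ✓ `…NewtonChartHonAnyField` replaces it (a maximal ideal of the chart ring is the ideal of a GEOMETRIC point over an
algebraically closed `K ⊇ k`, Mathlib `MvPolynomial.eq_vanishingIdeal_singleton_of_isMaximal`; Ishii's lemma over `K`; `∂ᵢ g_c ∉ Q`; field-general Jacobian criterion). Since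
`IsWeaklyNondegenerateAlong w f` quantifies over `k`-RATIONAL torus points, the honest hypothesis over a general field is GEOMETRIC weak non-degeneracy:
`∀ w > 0, IsWeaklyNondegenerateAlong w ↑(map (algebraMap k K) f)` for an algebraically closed extension `K` (for `k = k̄`, `K := k` recovers the old hypothesis since `map (algebraMap k k) f = f`;
for the census beds the Specimen lemmas `weaklyNondegenerate (k) [Field k] [CharP k p]` hold over every field, in particular over `K := AlgebraicClosure k`).
* §1 `affineBlowup_fullCl_of_convenient_anyField` — (B″) over any field;
* §2 ★ `fHalfRow_of_convenient_anyField` — THE F-HALF AT CLASS LEVEL over any field of characteristic `p` (point floor CURED);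
* §3 ★ `pointFloorRow_of_convenient_anyField` — the two-sided census letter ⟨LEGAL, NOT FULL, CURED⟩ over any field (+ the elementary per-bed chart/Fedder data, all field-general:
  ✓ `PointFloorLegalOfIsolated`, ✓ `PointFloorNotFullOfFedder` — no `PerfectRing` hypothesis anywhere: `FullCl p` is Frobenius closure of parameter ideals of the local ring itself);
* §4 `pointFloorRow_of_convenient_anyField_of_ringEquiv` — along origin-fixing coordinate changes (✓ p678625 `PolyAutRowTransport.pointFloorRow_of_algEquiv`, field-general).
SCOPE CAVEAT (desk, binding): this closes the GAP-2 member «k ≠ k̄» AT `k`-RATIONAL VERTICES (`v.asIdeal = (x̄₀,…,x̄_{n−1})`; the census beds: the vertex is the origin). Singular closed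
points whose residue field is a proper finite extension of `k` stay in GAP-2 (route: base change to `K` + descent of FULL along the faithfully flat local map — not done here).
[cite: IshiiSingularities2018, Thm. 4.4.23 and Cor. 4.4.25] [cite: Fedder1983, Thm. 1.12] [cite: GortzWedhorn2020, (13.19)] [cite: StacksProject, Tag 080A] [cite: Matsumura1987, Thm. 5.3]
-/

-- single-problem summit: the doubled namespace component is forced
set_option linter.dupNamespace false

noncomputable section

namespace Summit.ResolutionOfSingularities.ResolutionOfSingularities.Theorems.FInjectiveMacaulayfication.F108ClassRowAnyField

open CategoryTheory CategoryTheory.Limits AlgebraicGeometry TopologicalSpace IsLocalRing MvPolynomial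
open Literature.AlgebraicGeometry.Resolution Literature.AlgebraicGeometry.Resolution.BoubakriGreuelMarkwig
open Summit.ResolutionOfSingularities.ResolutionOfSingularities.Theorems.FInjectiveMacaulayfication
open SliceableCentre

variable (k : Type) [Field k] (K : Type) [Field K] [Algebra k K] [IsAlgClosed K] {n : ℕ}

/-! ## §1 (B″) over any field -/

/-- **(B″) OVER ANY FIELD**: for `f` prime, convenient, GEOMETRICALLY weakly non-degenerate along every positive weight (`map (algebraMap k K) f`, `K ⊇ k` algebraically closed), with
`x̄ᵢ ≠ 0` and `X = V(f)` regular off the vertex (`k` ANY field of characteristic `p`), there is an `𝔪`-primary monomial centre `(x^A)` whose affine blowup is FULL at every point;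
the toric data come from ✓ `F108ClassRow.F108Consumable_holds`. UNCONDITIONAL. [OURS · class theorem; cite: IshiiSingularities2018, Thm. 4.4.23 and Cor. 4.4.25] -/
theorem affineBlowup_fullCl_of_convenient_anyField (p : ℕ) [Fact p.Prime] [CharP k p]
    (f : MvPolynomial (Fin n) k) (hfp : Prime f) (hconv : ∀ j : Fin n, ∃ N : ℕ, 0 < N ∧ MvPolynomial.coeff (Finsupp.single j N) f ≠ 0)
    (hWND : ∀ w : Fin n → ℝ, (∀ i, 0 < w i) →
      IsWeaklyNondegenerateAlong w ((map (algebraMap k K) f : MvPolynomial (Fin n) K) : MvPowerSeries (Fin n) K))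
    (hXne : ∀ v : Fin n, Ideal.Quotient.mk (Ideal.span {f}) (X v) ≠ 0)
    (hreg : ∀ x : Spec (.of (MvPolynomial (Fin n) k ⧸ Ideal.span {f})),
      ¬ Ideal.span (Set.range fun j : Fin n => Ideal.Quotient.mk (Ideal.span {f}) (X j)) ≤ x.asIdeal → IsRegularLocalRing (Localization.AtPrime x.asIdeal)) :
    ∃ A : Finset (Fin n →₀ ℕ), (∀ j ∈ (Finset.univ : Finset (Fin n)), ∃ N : ℕ, Finsupp.single j N ∈ A) ∧
      ∀ y : ↥(affineBlowup (Ideal.span ((fun e : Fin n →₀ ℕ => Ideal.Quotient.mk (Ideal.span {f}) (monomial e (1 : k))) '' (A : Set (Fin n →₀ ℕ))))),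
        FullCl p ((affineBlowup (Ideal.span ((fun e : Fin n →₀ ℕ => Ideal.Quotient.mk (Ideal.span {f}) (monomial e (1 : k))) '' (A : Set (Fin n →₀ ℕ))))).presheaf.stalk y) := by
  obtain ⟨A, KA, t, m, V, a, g, d, -, -, hprim, hAJ, hcov, hV, haA, hgen, hge, hθ, hg0, hm⟩ := F108ClassRow.F108Consumable_holds k n f hconv
  refine ⟨A, hprim, ?_⟩
  have hv : ∀ c : Fin t, Ideal.Quotient.mk (Ideal.span {f}) (monomial (m c) (1 : k)) ∈
      Ideal.span ((fun e : Fin n →₀ ℕ => Ideal.Quotient.mk (Ideal.span {f}) (monomial e (1 : k))) '' (A : Set (Fin n →₀ ℕ))) :=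
    fun c => Ideal.subset_span ⟨m c, hm c, rfl⟩
  exact FHalfRowAnyField.affineBlowup_fullCl_of_geomWeaklyNondegenerate p k K f hfp hWND hXne hreg A hprim hAJ t m hcov V hV a haA hgen hge g d hθ hg0 hv

/-! ## §2 ★ The F-half (CURED) over any field -/

/-- ★ **THE F-HALF AT CLASS LEVEL OVER ANY FIELD OF CHARACTERISTIC `p`, UNCONDITIONAL**: for `f ∈ k[X₀..X_{n−1}]` (`n ≥ 1`, `k` ANY field of characteristic `p`) prime, CONVENIENT,
GEOMETRICALLY WEAKLY NON-DEGENERATE along every positive weight (`map (algebraMap k K) f`, `K ⊇ k` algebraically closed), with `x̄ᵢ ≠ 0` and `X = V(f)` regular off the `k`-rational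
vertex `v`: for EVERY blowing up `g : S′ → Spec 𝒪_{X,v}` along the point floor `𝔪̃|_{Spec 𝒪_{X,v}}` there is an ideal sheaf `𝓚 ≠ ⊥` on `S′`, supported over the closed point, ALL of
whose blowings up are FULL (`FullCl p`) at every stalk — the point floor is CURED. One term on `FHalfRowAnyField.fHalfRow_of_geomWeaklyNondegenerate` after unpacking
`F108Consumable_holds k n f`. The `[IsAlgClosed k]` of ✓ `F108ClassRow.fHalfRow_of_convenient` is gone; singular closed points with residue field ≠ `k` are NOT covered (GAP-2).
[OURS · class theorem; cite: IshiiSingularities2018, Thm. 4.4.23 and Cor. 4.4.25] [cite: StacksProject, Tag 080A] -/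
theorem fHalfRow_of_convenient_anyField (p : ℕ) [Fact p.Prime] [CharP k p] (hn : 0 < n)
    (f : MvPolynomial (Fin n) k) (hfp : Prime f) (hconv : ∀ j : Fin n, ∃ N : ℕ, 0 < N ∧ MvPolynomial.coeff (Finsupp.single j N) f ≠ 0)
    (hWND : ∀ w : Fin n → ℝ, (∀ i, 0 < w i) →
      IsWeaklyNondegenerateAlong w ((map (algebraMap k K) f : MvPolynomial (Fin n) K) : MvPowerSeries (Fin n) K))
    (hXne : ∀ v : Fin n, Ideal.Quotient.mk (Ideal.span {f}) (X v) ≠ 0)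
    (hreg : ∀ x : Spec (.of (MvPolynomial (Fin n) k ⧸ Ideal.span {f})),
      ¬ Ideal.span (Set.range fun j : Fin n => Ideal.Quotient.mk (Ideal.span {f}) (X j)) ≤ x.asIdeal → IsRegularLocalRing (Localization.AtPrime x.asIdeal))
    (v : Spec (.of (MvPolynomial (Fin n) k ⧸ Ideal.span {f})))
    (hvm : v.asIdeal = Ideal.span (Set.range fun j : Fin n => Ideal.Quotient.mk (Ideal.span {f}) (X j))) :
    ∀ (S' : Scheme.{0}) (gS : S' ⟶ Spec ((Spec (.of (MvPolynomial (Fin n) k ⧸ Ideal.span {f}))).presheaf.stalk v)),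
      IsBlowup gS ((affineBlowup.idealSheaf (Ideal.span (Set.range fun j : Fin n => Ideal.Quotient.mk (Ideal.span {f}) (X j)))).comap
        ((Spec (.of (MvPolynomial (Fin n) k ⧸ Ideal.span {f}))).fromSpecStalk v)) →
      ∃ 𝓚 : S'.IdealSheafData, 𝓚 ≠ ⊥ ∧
        (∀ s ∈ (𝓚.support : Set S'), gS.base s = closedPoint ((Spec (.of (MvPolynomial (Fin n) k ⧸ Ideal.span {f}))).presheaf.stalk v)) ∧
        ∀ (S'' : Scheme.{0}) (π : S'' ⟶ S'), IsBlowup π 𝓚 → ∀ s : S'', FullCl p (S''.presheaf.stalk s) := by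
  obtain ⟨A, KA, t, m, V, a, g, d, hIA, hKprim, hprim, hAJ, hcov, hV, haA, hgen, hge, hθ, hg0, hm⟩ := F108ClassRow.F108Consumable_holds k n f hconv
  have hv : ∀ c : Fin t, Ideal.Quotient.mk (Ideal.span {f}) (monomial (m c) (1 : k)) ∈
      Ideal.span ((fun e : Fin n →₀ ℕ => Ideal.Quotient.mk (Ideal.span {f}) (monomial e (1 : k))) '' (A : Set (Fin n →₀ ℕ))) :=
    fun c => Ideal.subset_span ⟨m c, hm c, rfl⟩
  exact FHalfRowAnyField.fHalfRow_of_geomWeaklyNondegenerate p k K hn f hfp hWND hXne hreg A KA (F108ClassRow.span_quotient_eq_mul k _ A KA hIA) hKprim hprim hAJ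
    t m hcov V hV a haA hgen hge g d hθ hg0 hv v hvm

/-! ## §3 ★ The two-sided census letter over any field -/

/-- ★ **THE TWO-SIDED CENSUS ROW AT CLASS LEVEL OVER ANY FIELD OF CHARACTERISTIC `p`, UNCONDITIONAL: LEGAL ∧ NOT FULL ∧ CURED.** Hypotheses: the class hypotheses of §2 (prime,
convenient, GEOMETRICALLY weakly non-degenerate, `x̄ᵢ ≠ 0`, regular off the `k`-rational vertex `v`, `v` singular) and the ELEMENTARY per-bed data of the point blow-up — the chart identities `θᵢ f = Xᵢ^{μᵢ}·gᵢ` with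
`f, gᵢ ∉ (Xᵢ)`, `f(0) = 0`, and ONE Fedder certificate at the origin of chart `i₀`: `g_{i₀}(0) = 0`, `g_{i₀}^{p−1} ∈ (X₀^p,…,X_{n−1}^p)`. Conclusion, for every blowing up
`g : S′ → Spec 𝒪_{X,v}` along the point floor: (LEGAL) centre `≠ ⊥`, supported in the non-regular locus, `S′` regular off the closed fibre and CM everywhere; (NOT FULL) some stalk
of `S′` over the closed point is not `FullCl p`; (CURED) §2. No `PerfectRing k` hypothesis: the Fedder-type criteria of record (`PointFloorNotFullOfFedder`) are stated for every field of
characteristic `p`. [OURS · class theorem; cite: Fedder1983, Thm. 1.12] [cite: IshiiSingularities2018, Thm. 4.4.23] -/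
theorem pointFloorRow_of_convenient_anyField (p : ℕ) [Fact p.Prime] [CharP k p] (hn : 0 < n)
    (f : MvPolynomial (Fin n) k) (hfp : Prime f) (hconv : ∀ j : Fin n, ∃ N : ℕ, 0 < N ∧ MvPolynomial.coeff (Finsupp.single j N) f ≠ 0)
    (hWND : ∀ w : Fin n → ℝ, (∀ i, 0 < w i) →
      IsWeaklyNondegenerateAlong w ((map (algebraMap k K) f : MvPolynomial (Fin n) K) : MvPowerSeries (Fin n) K))
    (hXne : ∀ v : Fin n, Ideal.Quotient.mk (Ideal.span {f}) (X v) ≠ 0)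
    (hreg : ∀ x : Spec (.of (MvPolynomial (Fin n) k ⧸ Ideal.span {f})),
      ¬ Ideal.span (Set.range fun j : Fin n => Ideal.Quotient.mk (Ideal.span {f}) (X j)) ≤ x.asIdeal → IsRegularLocalRing (Localization.AtPrime x.asIdeal))
    (μ : Fin n → ℕ) (gθ : Fin n → MvPolynomial (Fin n) k)
    (hθ : ∀ i : Fin n, aeval (fun j : Fin n => if j = i then (X i : MvPolynomial (Fin n) k) else X j * X i) f = X i ^ μ i * gθ i)
    (hfX : ∀ i : Fin n, f ∉ Ideal.span {(X i : MvPolynomial (Fin n) k)}) (hgX : ∀ i : Fin n, gθ i ∉ Ideal.span {(X i : MvPolynomial (Fin n) k)})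
    (hf0 : constantCoeff f = 0) (i₀ : Fin n) (hc : constantCoeff (gθ i₀) = 0)
    (hfed : gθ i₀ ^ (p - 1) ∈ Ideal.span (Set.range fun j : Fin n => (X j : MvPolynomial (Fin n) k) ^ p))
    (v : Spec (.of (MvPolynomial (Fin n) k ⧸ Ideal.span {f})))
    (hvm : v.asIdeal = Ideal.span (Set.range fun j : Fin n => Ideal.Quotient.mk (Ideal.span {f}) (X j)))
    (hsing : v ∉ Scheme.regularLocus (Spec (.of (MvPolynomial (Fin n) k ⧸ Ideal.span {f}))))
    (S' : Scheme.{0}) (gS : S' ⟶ Spec ((Spec (.of (MvPolynomial (Fin n) k ⧸ Ideal.span {f}))).presheaf.stalk v))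
    (hgS : IsBlowup gS ((affineBlowup.idealSheaf (Ideal.span (Set.range fun j : Fin n => Ideal.Quotient.mk (Ideal.span {f}) (X j)))).comap
      ((Spec (.of (MvPolynomial (Fin n) k ⧸ Ideal.span {f}))).fromSpecStalk v))) :
    (((affineBlowup.idealSheaf (Ideal.span (Set.range fun j : Fin n => Ideal.Quotient.mk (Ideal.span {f}) (X j)))).comap
        ((Spec (.of (MvPolynomial (Fin n) k ⧸ Ideal.span {f}))).fromSpecStalk v)) ≠ ⊥ ∧
      ((((affineBlowup.idealSheaf (Ideal.span (Set.range fun j : Fin n => Ideal.Quotient.mk (Ideal.span {f}) (X j)))).comap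
        ((Spec (.of (MvPolynomial (Fin n) k ⧸ Ideal.span {f}))).fromSpecStalk v)).support :
          Set (Spec ((Spec (.of (MvPolynomial (Fin n) k ⧸ Ideal.span {f}))).presheaf.stalk v))) ⊆
        (Scheme.regularLocus (Spec ((Spec (.of (MvPolynomial (Fin n) k ⧸ Ideal.span {f}))).presheaf.stalk v)))ᶜ) ∧
      (∀ s : S', gS.base s ≠ closedPoint _ → s ∈ Scheme.regularLocus S') ∧ (∀ s : S', CMCl (S'.presheaf.stalk s))) ∧
    (∃ s : S', gS.base s = closedPoint _ ∧ ¬ FullCl p (S'.presheaf.stalk s)) ∧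
    (∃ 𝓚 : S'.IdealSheafData, 𝓚 ≠ ⊥ ∧ (∀ s ∈ (𝓚.support : Set S'), gS.base s = closedPoint _) ∧
      ∀ (S'' : Scheme.{0}) (π : S'' ⟶ S'), IsBlowup π 𝓚 → ∀ s : S'', FullCl p (S''.presheaf.stalk s)) := by
  have hreg' : ∀ y : Spec (.of (MvPolynomial (Fin n) k ⧸ Ideal.span {f})), y ⤳ v → y ≠ v →
      y ∈ Scheme.regularLocus (Spec (.of (MvPolynomial (Fin n) k ⧸ Ideal.span {f}))) := by
    intro y hy hne
    refine FermatCubicConeGerm.mem_regularLocus_Spec_of_isRegularLocalRing y (hreg y fun hle => hne ?_)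
    have hyv : y.asIdeal ≤ v.asIdeal := (PrimeSpectrum.le_iff_specializes y v).mpr hy
    exact PrimeSpectrum.ext (le_antisymm hyv (hvm ▸ hle))
  exact ⟨PointFloorLegalOfIsolated.pointFloor_input_legal k f hfp hn μ gθ hθ hfX hgX v hvm hsing hreg' S' gS hgS,
    PointFloorNotFullOfFedder.pointFloor_not_full p k f hfp μ gθ hθ hfX hgX hf0 i₀ hc hfed v hvm S' gS hgS,
    fHalfRow_of_convenient_anyField k K p hn f hfp hconv hWND hXne hreg v hvm S' gS hgS⟩

/-! ## §4 Along coordinate changes fixing the origin, any field -/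

/-- **The two-sided row for `V(f)` from the any-field class hypotheses for `f′ = φ f`** (`φ` a ring automorphism of `k[X]` with `φ(Xᵢ)`, `φ⁻¹(Xᵢ)` constant-term-free, e.g. the
`exists_translate` instances `Xⱼ ↦ Xⱼ + c·Xᵢ^b`): ✓ `PolyAutRowTransport.pointFloorRow_of_algEquiv` (field-general) on §3 for `f′`. UNCONDITIONAL, ANY field of characteristic `p`. So a
bed that is convenient and geometrically weakly non-degenerate in SOME coordinates of this kind gets its row over its field of definition. [OURS · class theorem; cite: GortzWedhorn2020, (13.19)] -/
theorem pointFloorRow_of_convenient_anyField_of_ringEquiv (p : ℕ) [Fact p.Prime] [CharP k p] (hn : 0 < n)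
    (φ : MvPolynomial (Fin n) k ≃+* MvPolynomial (Fin n) k)
    (h₁ : ∀ i : Fin n, constantCoeff (φ (X i)) = 0) (h₂ : ∀ i : Fin n, constantCoeff (φ.symm (X i)) = 0)
    (f f' : MvPolynomial (Fin n) k) (hff' : φ f = f') (hfp : Prime f') (hconv : ∀ j : Fin n, ∃ N : ℕ, 0 < N ∧ MvPolynomial.coeff (Finsupp.single j N) f' ≠ 0)
    (hWND : ∀ w : Fin n → ℝ, (∀ i, 0 < w i) →
      IsWeaklyNondegenerateAlong w ((map (algebraMap k K) f' : MvPolynomial (Fin n) K) : MvPowerSeries (Fin n) K))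
    (hXne : ∀ v : Fin n, Ideal.Quotient.mk (Ideal.span {f'}) (X v) ≠ 0)
    (hreg : ∀ x : Spec (.of (MvPolynomial (Fin n) k ⧸ Ideal.span {f'})),
      ¬ Ideal.span (Set.range fun j : Fin n => Ideal.Quotient.mk (Ideal.span {f'}) (X j)) ≤ x.asIdeal → IsRegularLocalRing (Localization.AtPrime x.asIdeal))
    (μ : Fin n → ℕ) (gθ : Fin n → MvPolynomial (Fin n) k)
    (hθ : ∀ i : Fin n, aeval (fun j : Fin n => if j = i then (X i : MvPolynomial (Fin n) k) else X j * X i) f' = X i ^ μ i * gθ i)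
    (hfX : ∀ i : Fin n, f' ∉ Ideal.span {(X i : MvPolynomial (Fin n) k)}) (hgX : ∀ i : Fin n, gθ i ∉ Ideal.span {(X i : MvPolynomial (Fin n) k)})
    (hf0 : constantCoeff f' = 0) (i₀ : Fin n) (hc : constantCoeff (gθ i₀) = 0)
    (hfed : gθ i₀ ^ (p - 1) ∈ Ideal.span (Set.range fun j : Fin n => (X j : MvPolynomial (Fin n) k) ^ p))
    (hsing : ∀ v : Spec (.of (MvPolynomial (Fin n) k ⧸ Ideal.span {f'})),
      v.asIdeal = Ideal.span (Set.range fun j : Fin n => Ideal.Quotient.mk (Ideal.span {f'}) (X j)) →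
      v ∉ Scheme.regularLocus (Spec (.of (MvPolynomial (Fin n) k ⧸ Ideal.span {f'})))) :
    ∀ (v' : Spec (.of (MvPolynomial (Fin n) k ⧸ Ideal.span {f}))),
      v'.asIdeal = Ideal.span (Set.range fun j : Fin n => Ideal.Quotient.mk (Ideal.span {f}) (X j)) →
      ∀ (S' : Scheme.{0}) (g₁ : S' ⟶ Spec ((Spec (.of (MvPolynomial (Fin n) k ⧸ Ideal.span {f}))).presheaf.stalk v')),
        IsBlowup g₁ ((affineBlowup.idealSheaf (Ideal.span (Set.range fun j : Fin n => Ideal.Quotient.mk (Ideal.span {f}) (X j)))).comap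
          ((Spec (.of (MvPolynomial (Fin n) k ⧸ Ideal.span {f}))).fromSpecStalk v')) →
        (((affineBlowup.idealSheaf (Ideal.span (Set.range fun j : Fin n => Ideal.Quotient.mk (Ideal.span {f}) (X j)))).comap
            ((Spec (.of (MvPolynomial (Fin n) k ⧸ Ideal.span {f}))).fromSpecStalk v')) ≠ ⊥ ∧
          ((((affineBlowup.idealSheaf (Ideal.span (Set.range fun j : Fin n => Ideal.Quotient.mk (Ideal.span {f}) (X j)))).comap
            ((Spec (.of (MvPolynomial (Fin n) k ⧸ Ideal.span {f}))).fromSpecStalk v')).support :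
              Set (Spec ((Spec (.of (MvPolynomial (Fin n) k ⧸ Ideal.span {f}))).presheaf.stalk v'))) ⊆
            (Scheme.regularLocus (Spec ((Spec (.of (MvPolynomial (Fin n) k ⧸ Ideal.span {f}))).presheaf.stalk v')))ᶜ) ∧
          (∀ s : S', g₁.base s ≠ closedPoint _ → s ∈ Scheme.regularLocus S') ∧ (∀ s : S', CMCl (S'.presheaf.stalk s))) ∧
        (∃ s : S', g₁.base s = closedPoint _ ∧ ¬ FullCl p (S'.presheaf.stalk s)) ∧
        (∃ 𝓚 : S'.IdealSheafData, 𝓚 ≠ ⊥ ∧ (∀ s ∈ (𝓚.support : Set S'), g₁.base s = closedPoint _) ∧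
          ∀ (S'' : Scheme.{0}) (π : S'' ⟶ S'), IsBlowup π 𝓚 → ∀ s : S'', FullCl p (S''.presheaf.stalk s)) :=
  PolyAutRowTransport.pointFloorRow_of_algEquiv k p φ h₁ h₂ f f' hff' fun v hv S' g₁ hg₁ =>
    pointFloorRow_of_convenient_anyField k K p hn f' hfp hconv hWND hXne hreg μ gθ hθ hfX hgX hf0 i₀ hc hfed v hv (hsing v hv) S' g₁ hg₁

end Summit.ResolutionOfSingularities.ResolutionOfSingularities.Theorems.FInjectiveMacaulayfication.F108ClassRowAnyField

end
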